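import Summits.CriticalPhenomena.SAWScalingLimit.Theorems.SAWRenewalTightnessEventualTightVirginization
import Summits.CriticalPhenomena.SAWScalingLimit.Theorems.SAWRenewalTightnessEventualTightFiniteExterior

/-!
# `EventualTight`, line `Sketch` v9: the BOUNDED-EXTERIOR atom X2c₁ᵇ carries the bulk leaf

Crux stmt-CriticalPhenomena-1372 (`SAWRenewalTightness.EventualTight`; bulk child `BulkShellTight`, stmt-17588), line
`Sketch`, registration v9 (lead c6).  v8's registered atom X2c₁ᶠ (`stub_virginArcTraversalTightFinite`, ⇔ X2c₁ =
stmt-CriticalPhenomena-17940) quantifies over ALL finite exteriors `Λ ⊇ B̄(z₀, N)` of the virgin lattice disc, of any extent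
relative to `N`; the crux never needs that: virginization (V3/V4) only ever produces the exterior `Ω_δ ∖ (prefix ∪ suffix)`,
whose vertices reachable from the door lie in `meshDomain Ω δ`, i.e. within lattice distance `(sup_{w ∈ Ω} |w - y|)/δ =
C · N` of the centre, `C = C(Ω, y, R_c)`.  v9 therefore registers the WEAKER atom

* X2c₁ᵇ `VirginArcTraversalTightBounded`: for every `C` and `θ > 0` there are `k, N₀` such that for every configuration
  `(H, Λ)` virgin at `(z₀, N)`, `N ≥ N₀`, with `Λ` FINITE and `Λ ⊆ B̄(z₀, C·N)`, and every two doors, the `x_c`-mass of the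
  arcs making `k` weak vertex traversals of `D(z₀; 2N/5, 3N/5)` is `≤ θ ·` (mass of all arcs) — `k` may depend on the
  exterior's relative extent `C`;

and this file carries it to the bulk leaf at aspect two by LANDED rungs only:

* rung B `virginArcTraversalTightReach_of_bounded`: X2c₁ᵇ ⇒ X2c₁ʳ, the same bound for every `(H, Λ)` (any `Λ`) whose
  vertices `H`-reachable from the door `c` lie in `B̄(z₀, C·N)` — intersect `Λ` with `B̄(z₀, max(C,1)·N)`: the
  intersection is finite and virgin with the same doors, contains every arc from `c` (arcs are reachable), and has smaller
  arc mass (`tsum_subtype(_subtype)_mono_of_imp`, `finite_setOf_dist_toComplex_le` of `…FiniteExterior.lean`);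
* V4ʳ `bulkShellTightAtAspectTwo_of_virginArcTraversalTightReach`: the virginization glue of `…Virginization.lean`
  verbatim, except that X2c₁ʳ is invoked with `C = max 1 (r/R_c)`, `D.carrier ⊆ B̄(y, r)` (`JordanDomain.isBounded`): a
  vertex reachable from `c` in `Ω_δ = discreteDomainGraph Ω δ` is `c` itself (in the cut disc) or the end of an `Ω_δ`-edge,
  hence in `meshDomain Ω δ ⊆ meshVertices Ω δ`, so its mesh point lies in `Ω` and its lattice distance to `z₀ = y/δ` is
  `≤ r/δ = (r/R_c) · N`.

Consequences (`bulkShellTightAtAspectTwo_of_virginArcTraversalTightBounded`; X2c₁ᶠ ⇒ X2c₁ᵇ is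
`virginArcTraversalTightBounded_of_finite`, so stmt-17940 still closes everything it closed): the crux is
`⟸ E ∧ X2c₁ᵇ`, a single-scale, finite-volume statement about the critical `ℤ²` self-avoiding arc measure in planar graphs
of diameter `≤ 2C·N` containing a virgin `N`-disc.
[cite: DuminilCopinSmirnov2012, §2 (domain Markov property)] [cite: AizenmanBurchardDuke1999, §3.a]
-/

noncomputable section

open MeasureTheory Filter Topology Set Metric
open scoped ENNReal NNReal unitInterval
open Literature.Probability.RandomPlanarGeometry Literature.Probability.LatticeModels

namespace Summit.CriticalPhenomena.SAWScalingLimit.Theorems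

/-- **Rung B — X2c₁ᵇ ⇒ X2c₁ʳ**: the bounded-finite-exterior atom gives the same traversal bound for every configuration
whose vertices reachable from the door lie within `C·N` of the centre.  Intersect `Λ` with the closed lattice ball of radius
`max(C,1)·N`: finite (`finite_setOf_dist_toComplex_le`), still virgin (the `N`-disc lies inside), same doors; every arc from
`c` stays inside it (its vertices are reachable from `c`, `SimpleGraph.Walk.takeUntil`), and its arc mass is at most that
of `Λ` (`tsum_subtype_mono_of_imp`). [folklore] -/
theorem virginArcTraversalTightReach_of_bounded :
    (∀ C θ : ℝ, 0 < θ →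
      ∃ (k : ℕ) (N₀ : ℝ), 0 < N₀ ∧
        ∀ (H : SimpleGraph (Site 2)) (Λ : Set (Site 2)) (z₀ : ℂ) (N : ℝ) (u c u' c' : Site 2),
          Λ.Finite → (∀ v ∈ Λ, dist (Site.toComplex v) z₀ ≤ C * N) → N₀ ≤ N →
          (H ≤ zdGraph 2 ∧ (∀ v : Site 2, dist (Site.toComplex v) z₀ ≤ N → v ∈ Λ) ∧
            ∀ v v' : Site 2, dist (Site.toComplex v) z₀ ≤ N + 1 →
              dist (Site.toComplex v') z₀ ≤ N + 1 → (zdGraph 2).Adj v v' → H.Adj v v') →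
          (H.Adj u c ∧ u ∉ Λ ∧ c ∈ Λ ∧ dist (Site.toComplex c) z₀ ≤ N ∧
            N < dist (Site.toComplex u) z₀) →
          (H.Adj u' c' ∧ u' ∉ Λ ∧ c' ∈ Λ ∧ dist (Site.toComplex c') z₀ ≤ N ∧
            N < dist (Site.toComplex u') z₀) →
          ∑' p : {p : {p : H.Walk c c' // p.IsPath ∧ ∀ v ∈ p.support, v ∈ Λ} //
              ∃ ι κ : Fin k → Fin (p.1.support.map Site.toComplex).length, (∀ m, ι m ≤ κ m) ∧
                (∀ m, (dist ((p.1.support.map Site.toComplex).get (ι m)) z₀ ≤ 2 * N / 5 ∧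
                    3 * N / 5 ≤ dist ((p.1.support.map Site.toComplex).get (κ m)) z₀) ∨
                  (3 * N / 5 ≤ dist ((p.1.support.map Site.toComplex).get (ι m)) z₀ ∧
                    dist ((p.1.support.map Site.toComplex).get (κ m)) z₀ ≤ 2 * N / 5)) ∧
                ∀ ⦃m m'⦄, m < m' → κ m ≤ ι m'},
              ENNReal.ofReal (SAW.criticalFugacity ^ p.1.1.length) ≤
            ENNReal.ofReal θ *
              ∑' p : {p : H.Walk c c' // p.IsPath ∧ ∀ v ∈ p.support, v ∈ Λ},
                ENNReal.ofReal (SAW.criticalFugacity ^ p.1.length)) →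
    ∀ C θ : ℝ, 0 < θ →
      ∃ (k : ℕ) (N₀ : ℝ), 0 < N₀ ∧
        ∀ (H : SimpleGraph (Site 2)) (Λ : Set (Site 2)) (z₀ : ℂ) (N : ℝ) (u c u' c' : Site 2),
          (∀ v ∈ Λ, H.Reachable c v → dist (Site.toComplex v) z₀ ≤ C * N) → N₀ ≤ N →
          (H ≤ zdGraph 2 ∧ (∀ v : Site 2, dist (Site.toComplex v) z₀ ≤ N → v ∈ Λ) ∧
            ∀ v v' : Site 2, dist (Site.toComplex v) z₀ ≤ N + 1 →
              dist (Site.toComplex v') z₀ ≤ N + 1 → (zdGraph 2).Adj v v' → H.Adj v v') →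
          (H.Adj u c ∧ u ∉ Λ ∧ c ∈ Λ ∧ dist (Site.toComplex c) z₀ ≤ N ∧
            N < dist (Site.toComplex u) z₀) →
          (H.Adj u' c' ∧ u' ∉ Λ ∧ c' ∈ Λ ∧ dist (Site.toComplex c') z₀ ≤ N ∧
            N < dist (Site.toComplex u') z₀) →
          ∑' p : {p : {p : H.Walk c c' // p.IsPath ∧ ∀ v ∈ p.support, v ∈ Λ} //
              ∃ ι κ : Fin k → Fin (p.1.support.map Site.toComplex).length, (∀ m, ι m ≤ κ m) ∧
                (∀ m, (dist ((p.1.support.map Site.toComplex).get (ι m)) z₀ ≤ 2 * N / 5 ∧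
                    3 * N / 5 ≤ dist ((p.1.support.map Site.toComplex).get (κ m)) z₀) ∨
                  (3 * N / 5 ≤ dist ((p.1.support.map Site.toComplex).get (ι m)) z₀ ∧
                    dist ((p.1.support.map Site.toComplex).get (κ m)) z₀ ≤ 2 * N / 5)) ∧
                ∀ ⦃m m'⦄, m < m' → κ m ≤ ι m'},
              ENNReal.ofReal (SAW.criticalFugacity ^ p.1.1.length) ≤
            ENNReal.ofReal θ *
              ∑' p : {p : H.Walk c c' // p.IsPath ∧ ∀ v ∈ p.support, v ∈ Λ},
                ENNReal.ofReal (SAW.criticalFugacity ^ p.1.length) := by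
  classical
  intro hX C θ hθ
  obtain ⟨k, N₀, hN₀, hk⟩ := hX (max C 1) θ hθ
  refine ⟨k, N₀, hN₀, fun H Λ z₀ N u c u' c' hreach hN hV hD hD' => ?_⟩
  have hNnn : 0 ≤ N := hN₀.le.trans hN
  have hNle : N ≤ max C 1 * N := le_mul_of_one_le_left hNnn (le_max_right C 1)
  have hCle : C * N ≤ max C 1 * N := mul_le_mul_of_nonneg_right (le_max_left C 1) hNnn
  set Λ' : Set (Site 2) := Λ ∩ {v : Site 2 | dist (Site.toComplex v) z₀ ≤ max C 1 * N} with hΛ'_def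
  have hfin : Λ'.Finite := (finite_setOf_dist_toComplex_le z₀ (max C 1 * N)).subset inter_subset_right
  have hbd : ∀ v ∈ Λ', dist (Site.toComplex v) z₀ ≤ max C 1 * N := fun v hv => hv.2
  have hV' : H ≤ zdGraph 2 ∧ (∀ v : Site 2, dist (Site.toComplex v) z₀ ≤ N → v ∈ Λ') ∧
      ∀ v v' : Site 2, dist (Site.toComplex v) z₀ ≤ N + 1 →
        dist (Site.toComplex v') z₀ ≤ N + 1 → (zdGraph 2).Adj v v' → H.Adj v v' :=
    ⟨hV.1, fun v hv => ⟨hV.2.1 v hv, hv.trans hNle⟩, hV.2.2⟩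
  have hc : c ∈ Λ' := ⟨hD.2.2.1, hD.2.2.2.1.trans hNle⟩
  have hc' : c' ∈ Λ' := ⟨hD'.2.2.1, hD'.2.2.2.1.trans hNle⟩
  have hstep := hk H Λ' z₀ N u c u' c' hfin hbd hN hV'
    ⟨hD.1, fun h => hD.2.1 h.1, hc, hD.2.2.2.1, hD.2.2.2.2⟩
    ⟨hD'.1, fun h => hD'.2.1 h.1, hc', hD'.2.2.2.1, hD'.2.2.2.2⟩
  -- every arc from `c` in `Λ` is an arc in `Λ'` (its vertices are reachable from `c`)
  have harc : ∀ p : H.Walk c c', (p.IsPath ∧ ∀ v ∈ p.support, v ∈ Λ) →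
      (p.IsPath ∧ ∀ v ∈ p.support, v ∈ Λ') := fun p hp =>
    ⟨hp.1, fun v hv => ⟨hp.2 v hv,
      (hreach v (hp.2 v hv) ⟨p.takeUntil v hv⟩).trans hCle⟩⟩
  calc _ ≤ ∑' p : {p : {p : H.Walk c c' // p.IsPath ∧ ∀ v ∈ p.support, v ∈ Λ'} //
              ∃ ι κ : Fin k → Fin (p.1.support.map Site.toComplex).length, (∀ m, ι m ≤ κ m) ∧
                (∀ m, (dist ((p.1.support.map Site.toComplex).get (ι m)) z₀ ≤ 2 * N / 5 ∧
                    3 * N / 5 ≤ dist ((p.1.support.map Site.toComplex).get (κ m)) z₀) ∨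
                  (3 * N / 5 ≤ dist ((p.1.support.map Site.toComplex).get (ι m)) z₀ ∧
                    dist ((p.1.support.map Site.toComplex).get (κ m)) z₀ ≤ 2 * N / 5)) ∧
                ∀ ⦃m m'⦄, m < m' → κ m ≤ ι m'},
              ENNReal.ofReal (SAW.criticalFugacity ^ p.1.1.length) :=
        tsum_subtype_subtype_mono_of_imp
          (fun p : H.Walk c c' => ∃ ι κ : Fin k → Fin (p.support.map Site.toComplex).length, (∀ m, ι m ≤ κ m) ∧
            (∀ m, (dist ((p.support.map Site.toComplex).get (ι m)) z₀ ≤ 2 * N / 5 ∧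
                3 * N / 5 ≤ dist ((p.support.map Site.toComplex).get (κ m)) z₀) ∨
              (3 * N / 5 ≤ dist ((p.support.map Site.toComplex).get (ι m)) z₀ ∧
                dist ((p.support.map Site.toComplex).get (κ m)) z₀ ≤ 2 * N / 5)) ∧
            ∀ ⦃m m'⦄, m < m' → κ m ≤ ι m')
          (fun p : H.Walk c c' => ENNReal.ofReal (SAW.criticalFugacity ^ p.length)) harc
    _ ≤ ENNReal.ofReal θ *
          ∑' p : {p : H.Walk c c' // p.IsPath ∧ ∀ v ∈ p.support, v ∈ Λ'},
            ENNReal.ofReal (SAW.criticalFugacity ^ p.1.length) := hstep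
    _ ≤ _ := mul_le_mul' le_rfl
        (tsum_subtype_mono_of_imp (fun p : H.Walk c c' => ENNReal.ofReal (SAW.criticalFugacity ^ p.length))
          fun p hp => ⟨hp.1, fun v hv => (hp.2 v hv).1⟩)


/-- **V4ʳ — the virginization glue from the reach-bounded atom X2c₁ʳ**: per-shell traversal-count tightness on interior
shells of aspect two (`BulkShellTightAtAspectTwo`).  The proof of `bulkShellTightAtAspectTwo_of_virginArcTraversalTight`
(`…Virginization.lean`) verbatim, except that the atom is invoked with the relative extent `C = max 1 (r/R_c)` of the
domain, `Ω ⊆ B̄(y, r)` (`JordanDomain.isBounded`): on every fibre the vertices reachable from the door `c` in `Ω_δ` are `c`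
itself (inside the cut disc) or ends of `Ω_δ`-edges, hence mesh vertices of `Ω` (`discreteDomainGraph_adj_iff`,
`meshDomain_subset_meshVertices`), at lattice distance `≤ r/δ = (r/R_c)·N` from `z₀ = y/δ`.
[cite: DuminilCopinSmirnov2012, §2 (domain Markov property)] [cite: AizenmanBurchardDuke1999, §3.a] -/
theorem bulkShellTightAtAspectTwo_of_virginArcTraversalTightReach :
    (∀ C θ : ℝ, 0 < θ →
      ∃ (k : ℕ) (N₀ : ℝ), 0 < N₀ ∧
        ∀ (H : SimpleGraph (Site 2)) (Λ : Set (Site 2)) (z₀ : ℂ) (N : ℝ) (u c u' c' : Site 2),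
          (∀ v ∈ Λ, H.Reachable c v → dist (Site.toComplex v) z₀ ≤ C * N) → N₀ ≤ N →
          (H ≤ zdGraph 2 ∧ (∀ v : Site 2, dist (Site.toComplex v) z₀ ≤ N → v ∈ Λ) ∧
            ∀ v v' : Site 2, dist (Site.toComplex v) z₀ ≤ N + 1 →
              dist (Site.toComplex v') z₀ ≤ N + 1 → (zdGraph 2).Adj v v' → H.Adj v v') →
          (H.Adj u c ∧ u ∉ Λ ∧ c ∈ Λ ∧ dist (Site.toComplex c) z₀ ≤ N ∧
            N < dist (Site.toComplex u) z₀) →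
          (H.Adj u' c' ∧ u' ∉ Λ ∧ c' ∈ Λ ∧ dist (Site.toComplex c') z₀ ≤ N ∧
            N < dist (Site.toComplex u') z₀) →
          ∑' p : {p : {p : H.Walk c c' // p.IsPath ∧ ∀ v ∈ p.support, v ∈ Λ} //
              ∃ ι κ : Fin k → Fin (p.1.support.map Site.toComplex).length, (∀ m, ι m ≤ κ m) ∧
                (∀ m, (dist ((p.1.support.map Site.toComplex).get (ι m)) z₀ ≤ 2 * N / 5 ∧
                    3 * N / 5 ≤ dist ((p.1.support.map Site.toComplex).get (κ m)) z₀) ∨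
                  (3 * N / 5 ≤ dist ((p.1.support.map Site.toComplex).get (ι m)) z₀ ∧
                    dist ((p.1.support.map Site.toComplex).get (κ m)) z₀ ≤ 2 * N / 5)) ∧
                ∀ ⦃m m'⦄, m < m' → κ m ≤ ι m'},
              ENNReal.ofReal (SAW.criticalFugacity ^ p.1.1.length) ≤
            ENNReal.ofReal θ *
              ∑' p : {p : H.Walk c c' // p.IsPath ∧ ∀ v ∈ p.support, v ∈ Λ},
                ENNReal.ofReal (SAW.criticalFugacity ^ p.1.length)) →
    ∀ (D : DobrushinDomain) (a b : ℝ → Site 2), SAW.IsEndpointApprox D a b →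
      ∀ (y : ℂ) (η : ℝ), 0 < η → Metric.closedBall y (4 * η) ⊆ D.carrier →
        ∀ ε : ℝ, 0 < ε → ∃ (j : ℕ) (δ₁ : ℝ), 0 < δ₁ ∧ ∀ δ ∈ Set.Ioc (0 : ℝ) δ₁,
          SAW.law D.carrier δ (a δ) (b δ)
            {γ | (⟨γ.walk.toCurve (meshPoint δ)⟩ : Curve ℂ).HasTraversals j y η (2 * η)} ≤
            ENNReal.ofReal ε := by
  intro hX D a b hab y η hη hball ε hε
  -- radii
  set R : ℝ := 2 * η with hR_def
  have hR : 0 < R := by rw [hR_def]; linarith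
  set η' : ℝ := 6 * η / 5 with hη'_def
  set R' : ℝ := 9 * η / 5 with hR'_def
  set Rc : ℝ := 3 * η with hRc_def
  have hηη' : η < η' := by rw [hη'_def]; linarith
  have hη'R' : η' < R' := by rw [hη'_def, hR'_def]; linarith
  have hR'R : R' < R := by rw [hR'_def, hR_def]; linarith
  have hRRc : R < Rc := by rw [hRc_def, hR_def]; linarith
  have hRc : 0 < Rc := hR.trans hRRc
  -- the relative extent of the domain seen from the cut disc
  obtain ⟨r, hr⟩ := (Metric.isBounded_iff_subset_closedBall y).1 D.isBounded
  set C : ℝ := max 1 (r / Rc) with hC_def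
  have hC1 : 1 ≤ C := le_max_left _ _
  have hCr : r / Rc ≤ C := le_max_right _ _
  -- X2c₁ʳ, V2, V3
  obtain ⟨k, N₀, hN₀, hXk⟩ := hX C ε hε
  obtain ⟨δ₂, hδ₂, hT'⟩ := stub_travTransport y η η' R' R Rc hη hηη' hη'R' hR'R hRRc
  have hball' : Metric.closedBall y (Rc + η) ⊆ D.carrier := by
    have : Rc + η = 4 * η := by rw [hRc_def]; ring
    rw [this]; exact hball
  obtain ⟨δ₃, hδ₃, hV'⟩ := stub_virginConfig D y Rc η hRc hη hball'
  -- the marked points are outside `B̄(y, 4η)`, so the lattice endpoints leave `B̄(y, R_c)` eventually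
  have hout : ∀ i : Fin 2, Rc < dist (D.pt i) y := fun i => by
    refine lt_of_not_ge fun h => ?_
    have hmem : D.pt i ∈ D.carrier :=
      hball (Metric.mem_closedBall.2 (h.trans (by rw [hRc_def]; linarith)))
    have hfr := D.pt_mem_frontier i
    rw [frontier, interior_eq_iff_isOpen.2 D.isOpen] at hfr
    exact hfr.2 hmem
  have hopen : IsOpen {z : ℂ | Rc < dist z y} :=
    isOpen_lt continuous_const (continuous_id.dist continuous_const)
  obtain ⟨δa, hδa, hsubA⟩ := mem_nhdsGT_iff_exists_Ioo_subset.1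
    (hab.tendsto_fst.eventually_mem (hopen.mem_nhds (hout 0)))
  obtain ⟨δb, hδb, hsubB⟩ := mem_nhdsGT_iff_exists_Ioo_subset.1
    (hab.tendsto_snd.eventually_mem (hopen.mem_nhds (hout 1)))
  have hδa0 : (0 : ℝ) < δa := hδa
  have hδb0 : (0 : ℝ) < δb := hδb
  -- the mesh threshold
  refine ⟨k + 1, min (min δ₂ δ₃) (min (min (δa / 2) (δb / 2)) (Rc / N₀)), ?_, fun δ hδ => ?_⟩
  · refine lt_min (lt_min hδ₂ hδ₃) (lt_min (lt_min (half_pos hδa0) (half_pos hδb0)) ?_)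
    positivity
  obtain ⟨hδ0, hδle⟩ := hδ
  have hδδ₂ : δ ≤ δ₂ := hδle.trans ((min_le_left _ _).trans (min_le_left _ _))
  have hδδ₃ : δ ≤ δ₃ := hδle.trans ((min_le_left _ _).trans (min_le_right _ _))
  have hδδa : δ < δa :=
    (hδle.trans ((min_le_right _ _).trans ((min_le_left _ _).trans (min_le_left _ _)))).trans_lt
      (half_lt_self hδa0)
  have hδδb : δ < δb :=
    (hδle.trans ((min_le_right _ _).trans ((min_le_left _ _).trans (min_le_right _ _)))).trans_lt
      (half_lt_self hδb0)
  have hδN₀ : δ ≤ Rc / N₀ := hδle.trans ((min_le_right _ _).trans (min_le_right _ _))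
  -- lattice centre, cut radius, the far predicate
  set z₀ : ℂ := (δ : ℂ)⁻¹ * y with hz₀_def
  set N : ℝ := Rc / δ with hN_def
  have hδC : (δ : ℂ) ≠ 0 := Complex.ofReal_ne_zero.2 hδ0.ne'
  have hz₀ : (δ : ℂ) * z₀ = y := by rw [hz₀_def, ← mul_assoc, mul_inv_cancel₀ hδC, one_mul]
  have hN : δ * N = Rc := by rw [hN_def]; field_simp
  have hNnn : 0 ≤ N := by rw [hN_def]; positivity
  have hN₀N : N₀ ≤ N := by
    rw [hN_def, le_div_iff₀ hδ0]
    calc N₀ * δ ≤ N₀ * (Rc / N₀) := by gcongr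
      _ = Rc := by field_simp
  have hdist : ∀ v : Site 2, dist (meshPoint δ v) y = δ * dist (Site.toComplex v) z₀ := fun v => by
    rw [← hz₀, meshPoint, dist_eq_norm, dist_eq_norm, ← mul_sub, norm_mul, Complex.norm_real,
      Real.norm_of_nonneg hδ0.le]
  -- every mesh vertex of `Ω` is within `C · N` of the lattice centre
  have hmeshC : ∀ v : Site 2, v ∈ meshDomain D.carrier δ → dist (Site.toComplex v) z₀ ≤ C * N := by
    intro v hv
    have hvΩ : meshPoint δ v ∈ D.carrier := (meshDomain_subset_meshVertices _ _ hv)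
    have hvr : dist (meshPoint δ v) y ≤ r := Metric.mem_closedBall.1 (hr hvΩ)
    rw [hdist] at hvr
    have h1 : dist (Site.toComplex v) z₀ ≤ r / δ := by
      rw [le_div_iff₀ hδ0, mul_comm]; exact hvr
    have h2 : r / δ = r / Rc * N := by
      rw [hN_def]; field_simp
    calc dist (Site.toComplex v) z₀ ≤ r / δ := h1
      _ = r / Rc * N := h2
      _ ≤ C * N := mul_le_mul_of_nonneg_right hCr hNnn
  set far : Site 2 → Bool := fun v => decide (N < dist (Site.toComplex v) z₀) with hfar_def
  have hfar_true : ∀ v, far v = true ↔ N < dist (Site.toComplex v) z₀ := fun v => by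
    simp [hfar_def]
  have hfar_false : ∀ v, far v = false ↔ dist (Site.toComplex v) z₀ ≤ N := fun v => by
    simp [hfar_def]
  have hfar_of_mesh : ∀ v : Site 2, Rc < dist (meshPoint δ v) y → far v = true := fun v hv => by
    rw [hfar_true, hN_def, div_lt_iff₀ hδ0, mul_comm]
    rwa [hdist] at hv
  have ha₀ : far (a δ) = true := hfar_of_mesh _ (hsubA ⟨hδ0, hδδa⟩)
  have hb₀ : far (b δ) = true := hfar_of_mesh _ (hsubB ⟨hδ0, hδδb⟩)
  -- V2 and V3 at this mesh
  have hTδ := hT' δ ⟨hδ0, hδδ₂⟩ z₀ N hz₀ hN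
  have hVδ := hV' δ ⟨hδ0, hδδ₃⟩ z₀ N hz₀ hN
  -- the event and the domain-Markov inequality (V1)
  set E : Set (SAW.DomainSAW D.carrier δ (a δ) (b δ)) :=
    {γ | (⟨γ.walk.toCurve (meshPoint δ)⟩ : Curve ℂ).HasTraversals (k + 1) y η R} with hE_def
  have hW : SAW.weight D.carrier δ (a δ) (b δ) E ≤
      ENNReal.ofReal ε * SAW.weight D.carrier δ (a δ) (b δ) Set.univ := by
    refine stub_arcMarkov stub_arcFibre D.carrier δ (a δ) (b δ) far E
      (fun α => ∃ ι κ : Fin (k + 1) → Fin (α.map Site.toComplex).length, (∀ m, ι m ≤ κ m) ∧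
        (∀ m, (dist ((α.map Site.toComplex).get (ι m)) z₀ ≤ η' / δ ∧
            R' / δ ≤ dist ((α.map Site.toComplex).get (κ m)) z₀) ∨
          (R' / δ ≤ dist ((α.map Site.toComplex).get (ι m)) z₀ ∧
            dist ((α.map Site.toComplex).get (κ m)) z₀ ≤ η' / δ)) ∧
        ∀ ⦃m m'⦄, m < m' → κ m ≤ ι m')
      (ENNReal.ofReal ε) ha₀ hb₀ ?_ ?_ ?_
    · -- every walk of `E` enters the closed cut disc
      intro γ hγ
      obtain ⟨v, hv, hvN⟩ := (hTδ D.carrier (a δ) (b δ) γ (k + 1) hγ).1 (Nat.le_add_left 1 k)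
      exact ⟨v, hv, (hfar_false v).2 hvN⟩
    · -- `E` implies `A` on the middle piece
      intro γ hγ β α β' c c' u u' hL hc hc' hu hu' _ _ hβ hβ'
      exact (hTδ D.carrier (a δ) (b δ) γ (k + 1) hγ).2 β α β' c c' u u' hL hc hc' hu hu'
        (fun v hv => (hfar_true v).1 (hβ v hv)) (fun v hv => (hfar_true v).1 (hβ' v hv))
    · -- the arc inequality on every fibre: virgin configuration + doors (V3), reach bound, then X2c₁ʳ, then `k+1 → k`
      intro γ _ β α β' c c' u u' hL hc hc' hu hu' hfc hfc' hβ hβ'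
      obtain ⟨hvirgin, hdoor, hdoor'⟩ := hVδ (a δ) (b δ) γ β α β' c c' u u' hL hc hc' hu hu'
        ((hfar_false c).1 hfc) ((hfar_false c').1 hfc')
        (fun v hv => (hfar_true v).1 (hβ v hv)) (fun v hv => (hfar_true v).1 (hβ' v hv))
      have hreach : ∀ v ∈ {v : Site 2 | v ∉ β ∧ v ∉ β'},
          (discreteDomainGraph D.carrier δ).Reachable c v → dist (Site.toComplex v) z₀ ≤ C * N := by
        intro v _ hcv
        by_cases hvc : v = c
        · subst hvc
          exact (((hfar_false v).1 hfc).trans (le_mul_of_one_le_left hNnn hC1))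
        · obtain ⟨p⟩ := hcv
          obtain ⟨w, hadj, _, _⟩ := p.reverse.exists_eq_cons_of_ne hvc
          exact hmeshC v (discreteDomainGraph_adj_iff.1 hadj).2.1
      have hXthis := hXk (discreteDomainGraph D.carrier δ) {v : Site 2 | v ∉ β ∧ v ∉ β'} z₀ N
        u c u' c' hreach hN₀N hvirgin hdoor hdoor'
      have hNA : 2 * N / 5 = η' / δ := by
        rw [hN_def, hη'_def, hRc_def]; field_simp; ring
      have hNB : 3 * N / 5 = R' / δ := by
        rw [hN_def, hR'_def, hRc_def]; field_simp; ring
      rw [hNA, hNB] at hXthis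
      exact le_trans (tsum_vertexTraversals_succ_le (discreteDomainGraph D.carrier δ)
        {v : Site 2 | v ∉ β ∧ v ∉ β'} c c' k z₀ (η' / δ) (R' / δ)) hXthis
  -- conclude: `law E = Z⁻¹ · weight E ≤ ε`
  rw [SAW.law_apply_eq_inv_mul_weight]
  calc (SAW.weight D.carrier δ (a δ) (b δ) Set.univ)⁻¹ * SAW.weight D.carrier δ (a δ) (b δ) E
      ≤ (SAW.weight D.carrier δ (a δ) (b δ) Set.univ)⁻¹ *
          (ENNReal.ofReal ε * SAW.weight D.carrier δ (a δ) (b δ) Set.univ) := by gcongr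
    _ = ENNReal.ofReal ε * ((SAW.weight D.carrier δ (a δ) (b δ) Set.univ)⁻¹ *
          SAW.weight D.carrier δ (a δ) (b δ) Set.univ) := by rw [mul_left_comm]
    _ ≤ ENNReal.ofReal ε * 1 := by gcongr; exact ENNReal.inv_mul_le_one _
    _ = ENNReal.ofReal ε := mul_one _

end Summit.CriticalPhenomena.SAWScalingLimit.Theorems

end
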